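import Summits.Ventures.WeilGRH.FlatWindowAtoms
import Summits.Ventures.WeilGRH.FlatSumUnconditional
import Summits.Ventures.WeilGRH.FlatWindowConstantsExact
import Summits.RiemannHypothesis.RiemannHypothesis.Theorems.HandoffCramerBump
import HarnessLib

/-!
# rh-explicit (venture WeilGRH): GRH(χ) ⟹ `ord_{s=½} L(s,χ) ≤ (½ + 2c/log log q)·log q/log log q` whenever
  `ψ(t) ≤ c·t` below `(log q)²` — hence `(½ + 2.29/log log q)·log q/log log q` for EVERY `q ≥ 16`, and
  `(½ + 2.08/log log q)·log q/log log q` for `q ≤ e^{100}`, from ONE flat window and the tree's kernel-checked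
  Chebyshev bounds

Cell `rh-explicit`, WEIL TRACK (structure seat weil-3, gen11 → gen12).  GRH(χ) only (no hypothesis on `ζ`), no
floating point, no `native_decide`.  The flat-window multiplicity inequality of `FlatWindowAtoms`
(`two_mul_mul_zeroOrder_le_of_grh`: for `χ` primitive mod `q ≠ 1` with GRH(χ), every `a > 0`, every `τ`:
`2a·ord_{½+iτ}L(χ) ≤ log q − K_κ + [Re ψ(¼+iτ/2) − Re ψ(¼)] + 5/a + 2S(a)`) at the window `a = log log q`
(`eᵃ = log q`, prime powers below `(log q)²`), with the flat prime sum
`S(a) = Σ_{log n<2a} Λ(n)n^{-1/2}(1 − log n/2a)` bounded by Abel summation against a linear Chebyshev bound that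
is only needed ON THE WINDOW `[0, e^{2a}]`:

* (`FlatSumUnconditional`: `flatSum_le_of_psi_le_on` — `ψ(t) ≤ c·t` for `0 ≤ t ≤ e^{2a}` ⟹
  `S(a) ≤ c(2(eᵃ−1)/a − 1)`; `psi_le_mul_unconditional` — `ψ(x) ≤ 1.1422·x` for all `x ≥ 0`, standard axioms, from the
  kernel `lcm` computation below `10⁴` and Sylvester above; in print `ψ(x) < 1.03883x`, Rosser–Schoenfeld 1962 Thm 12);
* **`charCentralOrder_le_of_psi_le`** (the route, parametric): `χ` primitive mod `q ≥ 16`, GRH(χ), `c ≥ 1`,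
  `ψ(t) ≤ c·t` for `0 ≤ t ≤ (log q)²` ⟹ `ord_{s=½} L(s,χ) ≤ (½ + 2c/log log q)·log q/log log q` — NO additive
  constant (the window constant `K_κ ≥ 2.23` and the `−2c` of the Abel summation absorb the modulation cost `5/a`);
* **`charCentralOrder_le_explicit_of_grh`**: GRH(χ) ⟹ `ord_{s=½} L(s,χ) ≤ (½ + 2.29/log log q)·log q/log log q`
  for every `q ≥ 16`;
* **`charCentralOrder_le_explicit_of_grh_of_log_le`**: GRH(χ), `16 ≤ q`, `log q ≤ 100` ⟹
  `ord_{s=½} L(s,χ) ≤ (½ + 2.08/log log q)·log q/log log q` (only `ψ(t) ≤ 1.04t` for `t ≤ 10⁴` enters);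
* **`charZeroOrder_le_explicit_of_grh`** (every height): with `L = log q + log(1+|τ|)`,
  `ord_{s=½+iτ} L(s,χ) ≤ (½ + 2.29/log L)·L/log L + 2.1/log L`
  (`Re ψ(¼+iτ/2) ≤ log(1+|τ|) + 3`, `HandoffCramerBump`; `−Re ψ(¼) = γ + π/2 + 3 log 2 ≤ 4.33`).

CALIBRATION.  Iwaniec–Kowalski Prop 5.21: `≪ log 𝔮/log log 𝔮` (mechanism: positivity of one test);
Carneiro–Chandee–Milinovich 2015 Ex. 8 / `CentralOrderBound` (gen10): `(½ + o(1)) log q/log log q`; Brumer 1992 /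
Elkies–Watkins 2004 (elliptic curves): `½·(log N/log log N)(1 + log 8e/log log N + O((log log N)⁻²))`.  Numbers
(`2.08`-form / `2.29`-form): `5.6/6.0`, `5.6/6.0`, `6.0/6.4`, `6.8/7.2`, `7.7/8.1`, `9.4/9.9`, `12.5/13.2` at
`q = 10², 10³, 10⁴, 10⁶, 10⁸, 10¹², 10²⁰`; gen11's Sylvester-only version (`ψ ≤ 1.0722x + 7√x` at every `t`) carried
an additive `3.5 + 5.3/log log q` and read `15.8, 12.7, 12.0, 12.5, 13.2, 14.7, 17.7`; the unconditional explicit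
zero count `N(5/7, χ)` (Bennett–Martin–O'Bryant–Rechnitzer 2021, Thm 1.1) gives `4, 5, 7, 10, 13, 18, 27`.

No definitions, no named facts, standard axioms; GRH(χ) is the hypothesis of the last four theorems only.
-/

set_option autoImplicit false

noncomputable section

open Complex Filter Set MeasureTheory Finset
open scoped Real Topology Chebyshev ArithmeticFunction.vonMangoldt

namespace Summit.Ventures.WeilGRH

open Literature.NumberTheory.LFunctions
open Literature.Analysis.SpecialFunctions (reDigammaQuarter)

/-! ## Numerical constants -/

/-- `log 16 ≥ 2.77`, hence `log q ≥ 2.77` for `q ≥ 16`. -/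
private theorem log_ge_of_sixteen_le {q : ℕ} (hq : 16 ≤ q) : (2.77 : ℝ) ≤ Real.log q := by
  have hl2 := Real.log_two_gt_d9
  have hq16 : (16 : ℝ) ≤ q := by exact_mod_cast hq
  have h16 : Real.log 16 = 4 * Real.log 2 := by
    rw [show (16 : ℝ) = 2 ^ 4 by norm_num, Real.log_pow]; norm_num
  have := Real.log_le_log (by norm_num) hq16
  rw [h16] at this
  linarith

/-- `1 ≤ log ℓ` for `ℓ ≥ 2.77 > e`. -/
private theorem one_le_log_of_ge {ℓ : ℝ} (hℓ : 2.77 ≤ ℓ) : 1 ≤ Real.log ℓ := by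
  rw [← Real.log_exp 1]
  refine Real.log_le_log (Real.exp_pos 1) ?_
  have := Real.exp_one_lt_d9
  linarith

/-- `e^{2 log ℓ} = ℓ²` for `ℓ > 0`. -/
private theorem exp_two_mul_log {ℓ : ℝ} (hℓ : 0 < ℓ) : Real.exp (2 * Real.log ℓ) = ℓ ^ 2 := by
  rw [mul_comm, Real.exp_mul, Real.exp_log hℓ]; norm_cast

/-- `−Re ψ(¼) = γ + π/2 + 3 log 2 ≤ 4.33` (Gauss). -/
private theorem neg_reDigammaQuarter_zero_le : -reDigammaQuarter 0 ≤ 4.33 := by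
  have h : reDigammaQuarter 0 = -Real.eulerMascheroniConstant - π / 2 - 3 * Real.log 2 := by
    rw [Literature.Analysis.SpecialFunctions.reDigammaQuarter_zero,
      Literature.Analysis.SpecialFunctions.Complex.digamma_one_quarter_eq_neg_ofReal, Complex.neg_re,
      Complex.ofReal_re]
    ring
  rw [h]
  have hγ := Real.eulerMascheroniConstant_lt_two_thirds
  have hpi := Real.pi_lt_d2
  have hl2 := Real.log_two_lt_d9
  linarith

variable {q : ℕ} [NeZero q] {χ : DirichletCharacter ℂ q}

/-! ## The central point -/

/-- **THE ROUTE (parametric)**: for `χ` primitive mod `q ≥ 16` with GRH(χ) and any `c ≥ 1` with `ψ(t) ≤ c·t` for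
`0 ≤ t ≤ (log q)²`,

  `ord_{s=½} L(s, χ) ≤ (½ + 2c/log log q) · log q/log log q`

— one flat window of half-length `log log q`, the primes below `(log q)²` bounded by Abel summation; no additive
constant. -/
theorem charCentralOrder_le_of_psi_le (hq : 16 ≤ q) (hprim : χ.IsPrimitive) (hGRH : χ.RiemannHypothesis)
    {c : ℝ} (hc : 1 ≤ c) (hψ : ∀ t : ℝ, 0 ≤ t → t ≤ Real.log q ^ 2 → ψ t ≤ c * t) :
    (DirichletDisc.zeroOrder χ (1 / 2) : ℝ) ≤
      (1 / 2 + 2 * c / Real.log (Real.log q)) * (Real.log q / Real.log (Real.log q)) := by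
  have hq1 : q ≠ 1 := by omega
  set ℓ : ℝ := Real.log q with hℓ
  set b : ℝ := Real.log ℓ with hb
  have hℓ16 : 2.77 ≤ ℓ := log_ge_of_sixteen_le hq
  have hℓ0 : 0 < ℓ := by linarith
  have hb1 : 1 ≤ b := one_le_log_of_ge hℓ16
  have hb0 : 0 < b := by linarith
  have hexp : Real.exp b = ℓ := by rw [hb, Real.exp_log hℓ0]
  -- the window inequality at `τ = 0`, window `b`
  have h := two_mul_mul_zeroOrder_le_of_grh hq1 hprim hGRH hb0 0
  simp only [Complex.ofReal_zero, zero_mul, add_zero, sub_self] at h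
  -- the prime sum (Chebyshev bound needed below `e^{2b} = ℓ²` only) and the constant
  have hS := flatSum_le_of_psi_le_on (c := c) hb0 (fun t ht0 ht ↦ hψ t ht0 (by rwa [hb, exp_two_mul_log hℓ0] at ht))
  rw [hexp] at hS
  have hK := flatWindow_const_ge χ
  -- `2b·m ≤ ℓ + 4cℓ/b + (5 − 4c)/b − 2.23 − 2c`
  have hm : 2 * b * (DirichletDisc.zeroOrder χ (1 / 2) : ℝ) ≤
      ℓ + 4 * c * ℓ / b + (5 - 4 * c) / b - 2.23 - 2 * c := by
    have e : 2 * (c * (2 * (ℓ - 1) / b - 1)) + 5 / b = 4 * c * ℓ / b + (5 - 4 * c) / b - 2 * c := by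
      field_simp; ring
    nlinarith [e]
  -- divide by `2b`; the lower-order terms are negative (`b ≥ 1`, `c ≥ 1`)
  have hdiv : (DirichletDisc.zeroOrder χ (1 / 2) : ℝ) ≤
      (ℓ + 4 * c * ℓ / b + (5 - 4 * c) / b - 2.23 - 2 * c) / (2 * b) := by
    rw [le_div_iff₀ (by positivity)]; linarith
  refine hdiv.trans ?_
  have key : (ℓ + 4 * c * ℓ / b + (5 - 4 * c) / b - 2.23 - 2 * c) / (2 * b) =
      (1 / 2 + 2 * c / b) * (ℓ / b) + ((5 - 4 * c) / (2 * b ^ 2) - (2.23 + 2 * c) / (2 * b)) := by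
    field_simp; ring
  rw [key]
  have hneg : (5 - 4 * c) / (2 * b ^ 2) - (2.23 + 2 * c) / (2 * b) ≤ 0 := by
    rw [sub_nonpos, div_le_div_iff₀ (by positivity) (by positivity)]
    nlinarith
  linarith

/-- **GRH(χ) ⟹ AN EXPLICIT CENTRAL-ORDER BOUND IN THE CONDUCTOR ASPECT, EVERY `q ≥ 16`**: for `χ` primitive
mod `q ≥ 16` with GRH(χ),

  `ord_{s=½} L(s, χ) ≤ (½ + 2.29/log log q) · log q/log log q`

(`psi_le_mul_unconditional`: `ψ ≤ 1.1422x`, kernel-checked; no additive constant, no floating point). -/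
theorem charCentralOrder_le_explicit_of_grh (hq : 16 ≤ q) (hprim : χ.IsPrimitive) (hGRH : χ.RiemannHypothesis) :
    (DirichletDisc.zeroOrder χ (1 / 2) : ℝ) ≤
      (1 / 2 + 2.29 / Real.log (Real.log q)) * (Real.log q / Real.log (Real.log q)) := by
  have h := charCentralOrder_le_of_psi_le hq hprim hGRH (c := 1.1422) (by norm_num)
    (fun t ht _ ↦ psi_le_mul_unconditional ht)
  have hℓ16 : 2.77 ≤ Real.log q := log_ge_of_sixteen_le hq
  have hb1 : 1 ≤ Real.log (Real.log q) := one_le_log_of_ge hℓ16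
  have hℓb : 0 ≤ Real.log q / Real.log (Real.log q) := by positivity
  refine h.trans (mul_le_mul_of_nonneg_right ?_ hℓb)
  gcongr; norm_num

/-- **… AND WITH THE PRINTED-SIZE CONSTANT FOR `q ≤ e^{100}`**: for `χ` primitive mod `q`, `16 ≤ q`,
`log q ≤ 100`, GRH(χ),

  `ord_{s=½} L(s, χ) ≤ (½ + 2.08/log log q) · log q/log log q`

— here `(log q)² ≤ 10⁴` and only the kernel computation `ψ(t) ≤ 1.04t` (`t ≤ 10⁴`) enters. -/
theorem charCentralOrder_le_explicit_of_grh_of_log_le (hq : 16 ≤ q) (hq' : Real.log q ≤ 100)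
    (hprim : χ.IsPrimitive) (hGRH : χ.RiemannHypothesis) :
    (DirichletDisc.zeroOrder χ (1 / 2) : ℝ) ≤
      (1 / 2 + 2.08 / Real.log (Real.log q)) * (Real.log q / Real.log (Real.log q)) := by
  have hℓ0 : 0 ≤ Real.log q := by linarith [log_ge_of_sixteen_le hq]
  have h := charCentralOrder_le_of_psi_le hq hprim hGRH (c := 1.04) (by norm_num) (fun t ht htq ↦
    SchoenfeldBound.psi_le_of_le_ten_thousand ht (htq.trans (by nlinarith)))
  norm_num at h ⊢
  exact h

/-! ## Every height -/

/-- **GRH(χ) ⟹ AN EXPLICIT MULTIPLICITY BOUND AT EVERY HEIGHT (parametric)**: for `χ` primitive mod `q ≥ 16`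
with GRH(χ), every `τ`, `L = log q + log(1+|τ|)`, and any `c ≥ 1` with `ψ(t) ≤ c·t` for `0 ≤ t ≤ L²`,

  `ord_{s=½+iτ} L(s, χ) ≤ (½ + 2c/log L) · L/log L + 2.1/log L`

(window `log L`; `Re ψ(¼+iτ/2) − Re ψ(¼) ≤ log(1+|τ|) + 7.33`). -/
theorem charZeroOrder_le_of_psi_le (hq : 16 ≤ q) (hprim : χ.IsPrimitive) (hGRH : χ.RiemannHypothesis)
    (τ : ℝ) {c : ℝ} (hc : 1 ≤ c)
    (hψ : ∀ t : ℝ, 0 ≤ t → t ≤ (Real.log q + Real.log (1 + |τ|)) ^ 2 → ψ t ≤ c * t) :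
    (DirichletDisc.zeroOrder χ (1 / 2 + τ * I) : ℝ) ≤
      (1 / 2 + 2 * c / Real.log (Real.log q + Real.log (1 + |τ|))) *
          ((Real.log q + Real.log (1 + |τ|)) / Real.log (Real.log q + Real.log (1 + |τ|))) +
        2.1 / Real.log (Real.log q + Real.log (1 + |τ|)) := by
  have hq1 : q ≠ 1 := by omega
  set L : ℝ := Real.log q + Real.log (1 + |τ|) with hL
  set b : ℝ := Real.log L with hb
  have hlogτ : 0 ≤ Real.log (1 + |τ|) := Real.log_nonneg (by linarith [abs_nonneg τ])
  have hL16 : 2.77 ≤ L := by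
    have := log_ge_of_sixteen_le hq
    rw [hL]; linarith
  have hL0 : 0 < L := by linarith
  have hb1 : 1 ≤ b := one_le_log_of_ge hL16
  have hb0 : 0 < b := by linarith
  have hexp : Real.exp b = L := by rw [hb, Real.exp_log hL0]
  -- the window inequality at height `τ`, window `b`
  have h := two_mul_mul_zeroOrder_le_of_grh hq1 hprim hGRH hb0 τ
  have hS := flatSum_le_of_psi_le_on (c := c) hb0 (fun t ht0 ht ↦ hψ t ht0 (by rwa [hb, exp_two_mul_log hL0] at ht))
  rw [hexp] at hS
  have hK := flatWindow_const_ge χ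
  have hψτ := Summit.RiemannHypothesis.RiemannHypothesis.Theorems.Handoff.reDigammaQuarter_le_log_add_three τ
  have hψ0 := neg_reDigammaQuarter_zero_le
  -- `2b·m ≤ L + 4cL/b + (5 − 4c)/b + 5.10 − 2c`
  have hm : 2 * b * (DirichletDisc.zeroOrder χ (1 / 2 + τ * I) : ℝ) ≤
      L + 4 * c * L / b + (5 - 4 * c) / b + 5.10 - 2 * c := by
    have e : 2 * (c * (2 * (L - 1) / b - 1)) + 5 / b = 4 * c * L / b + (5 - 4 * c) / b - 2 * c := by
      field_simp; ring
    have hLdef : Real.log q + Real.log (1 + |τ|) = L := rfl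
    nlinarith [e]
  have hdiv : (DirichletDisc.zeroOrder χ (1 / 2 + τ * I) : ℝ) ≤
      (L + 4 * c * L / b + (5 - 4 * c) / b + 5.10 - 2 * c) / (2 * b) := by
    rw [le_div_iff₀ (by positivity)]; linarith
  refine hdiv.trans ?_
  have key : (L + 4 * c * L / b + (5 - 4 * c) / b + 5.10 - 2 * c) / (2 * b) =
      (1 / 2 + 2 * c / b) * (L / b) + ((5 - 4 * c) / (2 * b ^ 2) + (5.10 - 2 * c) / (2 * b)) := by
    field_simp; ring
  rw [key]
  have hrest : (5 - 4 * c) / (2 * b ^ 2) + (5.10 - 2 * c) / (2 * b) ≤ 2.1 / b := by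
    rw [div_add_div _ _ (by positivity) (by positivity), div_le_div_iff₀ (by positivity) (by positivity)]
    nlinarith [mul_pos hb0 hb0, mul_nonneg (sub_nonneg.2 hb1) (sub_nonneg.2 hc)]
  linarith

/-- **GRH(χ) ⟹ AN EXPLICIT MULTIPLICITY BOUND AT EVERY HEIGHT, EVERY `q ≥ 16`**: for `χ` primitive mod `q ≥ 16`
with GRH(χ) and every `τ`, with `L = log q + log(1+|τ|)`,

  `ord_{s=½+iτ} L(s, χ) ≤ (½ + 2.29/log L) · L/log L + 2.1/log L`

(the tree's unconditional `ψ(x) ≤ 1.1422x` for the primes; kernel-checked, no floating point). -/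
theorem charZeroOrder_le_explicit_of_grh (hq : 16 ≤ q) (hprim : χ.IsPrimitive) (hGRH : χ.RiemannHypothesis)
    (τ : ℝ) :
    (DirichletDisc.zeroOrder χ (1 / 2 + τ * I) : ℝ) ≤
      (1 / 2 + 2.29 / Real.log (Real.log q + Real.log (1 + |τ|))) *
          ((Real.log q + Real.log (1 + |τ|)) / Real.log (Real.log q + Real.log (1 + |τ|))) +
        2.1 / Real.log (Real.log q + Real.log (1 + |τ|)) := by
  have h := charZeroOrder_le_of_psi_le hq hprim hGRH τ (c := 1.1422) (by norm_num)
    (fun t ht _ ↦ psi_le_mul_unconditional ht)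
  have hlogτ : 0 ≤ Real.log (1 + |τ|) := Real.log_nonneg (by linarith [abs_nonneg τ])
  have hL16 : 2.77 ≤ Real.log q + Real.log (1 + |τ|) := by linarith [log_ge_of_sixteen_le hq]
  have hb1 : 1 ≤ Real.log (Real.log q + Real.log (1 + |τ|)) := one_le_log_of_ge hL16
  have hLb : 0 ≤ (Real.log q + Real.log (1 + |τ|)) / Real.log (Real.log q + Real.log (1 + |τ|)) := by
    have : 0 ≤ Real.log q + Real.log (1 + |τ|) := by linarith
    positivity
  have hmono : (1 / 2 + 2 * 1.1422 / Real.log (Real.log q + Real.log (1 + |τ|))) *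
        ((Real.log q + Real.log (1 + |τ|)) / Real.log (Real.log q + Real.log (1 + |τ|))) ≤
      (1 / 2 + 2.29 / Real.log (Real.log q + Real.log (1 + |τ|))) *
        ((Real.log q + Real.log (1 + |τ|)) / Real.log (Real.log q + Real.log (1 + |τ|))) := by
    refine mul_le_mul_of_nonneg_right ?_ hLb
    gcongr; norm_num
  linarith

end Summit.Ventures.WeilGRH

end
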